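import Summits.CriticalPhenomena.PercolationContinuityZ3.Theorems.PercNearOneGluingNoHeavyLowerTailFrontierDecRowsClusterBHK3Sandwich
import HarnessLib

/-!
# Conjecture G⁺ (`ClusterBHK3Pos`) ⟺ a QUANTITATIVE BHK inequality: the three-term identity

Support file (prover prim-ineq-prove-3 gen 11; `--supports stmt-CriticalPhenomena-4575`).  No sorries, no named facts, no definitions.
Sequel of `…FrontierDecRowsClusterBHK3Sandwich` (p246255).

A second, cleaner exact identity (pure algebra, ANY probability measure and events `X, Y, Z`, `U := Xᶜ`):
`μ(X)·E₃(X, Yᶜ, Zᶜ) = Cov(U,Y)·Cov(U,Z) + μ(X)·Cov(1_X, 1_{Yᶜ∩Zᶜ}) − Δ*`,  `Δ* := μ(X∩Y)μ(X∩Z) − μ(X)μ(X∩Y∩Z)`.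
For the percolation triple (`X = D = {S ↮ T}`, `Y = A` ↑ `C_S`, `Z = B` ↑ `C_T`) the first three quantities are `≥ 0` by Harris
(`Cov(U,A), Cov(U,B) ≥ 0`; `D` and `Aᶜ ∩ Bᶜ` are both decreasing) and `Δ* ≥ 0` is the BHK two-cluster deficit, so
  `m·E₃(D, Aᶜ, Bᶜ) = c_A·c_B + m·Cov(D, Aᶜ∩Bᶜ) − Δ*`   ("(≥0)·(≥0) + (≥0) − (≥0)"),
and CONJECTURE G⁺ (`ClusterBHK3Pos`) IS EQUIVALENT TO THE QUANTITATIVE BHK BOUND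
  (QBHK)  `μ(D∩A)μ(D∩B) − μ(D)μ(D∩A∩B) ≤ Cov(U,A)·Cov(U,B) + μ(D)·Cov(1_D, 1_{Aᶜ∩Bᶜ})`
("the negative-correlation deficit of the two cluster events given separation is at most the product of their Harris
covariances with the connection event plus `μ(D)` times the Harris covariance of the separation with the joint failure").
Normalised: `Δ′ ≤ u·[P(AᶜBᶜ|D) − P(AᶜBᶜ|U)] + u²·[P(A|U)−P(A|D)]·[P(B|U)−P(B|D)]`, `u = μ(U)`, `Δ′ = P(A|D)P(B|D) − P(AB|D)`;
tight (equality) on the two-edge star.  `sahiE3_sep_compl_nonneg_of_qbhk` / `qbhk_of_sahiE3_sep_compl_nonneg` record the equivalence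
pointwise (per `w, S, T, A, B`). -/


noncomputable section

namespace Summit.CriticalPhenomena.PercolationContinuityZ3.Theorems.FrontierDecRows

open MeasureTheory
open Literature.Probability.Percolation Literature.Probability.LatticeModels

section ThreeTerm

variable {Ω : Type*} [MeasurableSpace Ω] (μ : Measure Ω) [IsProbabilityMeasure μ]

/-- **The three-term identity** (any probability measure, measurable `X, Y, Z`):
`μ(X)·E₃(X, Yᶜ, Zᶜ) = [μ(Xᶜ∩Y) − μ(Xᶜ)μ(Y)]·[μ(Xᶜ∩Z) − μ(Xᶜ)μ(Z)] + μ(X)·[μ(X∩(Yᶜ∩Zᶜ)) − μ(X)μ(Yᶜ∩Zᶜ)]`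
`− [μ(X∩Y)μ(X∩Z) − μ(X)μ(X∩Y∩Z)]`. [this work] -/
theorem mul_sahiE3_compl_compl_eq {X Y Z : Set Ω} (hX : MeasurableSet X) (hY : MeasurableSet Y) (hZ : MeasurableSet Z) :
    μ.real X * sahiE3 μ X Yᶜ Zᶜ =
      (μ.real (Xᶜ ∩ Y) - μ.real Xᶜ * μ.real Y) * (μ.real (Xᶜ ∩ Z) - μ.real Xᶜ * μ.real Z)
        + μ.real X * (μ.real (X ∩ (Yᶜ ∩ Zᶜ)) - μ.real X * μ.real (Yᶜ ∩ Zᶜ))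
        - (μ.real (X ∩ Y) * μ.real (X ∩ Z) - μ.real X * μ.real (X ∩ Y ∩ Z)) := by
  have hXc : μ.real Xᶜ = 1 - μ.real X := probReal_compl_eq_one_sub hX
  have h1 : μ.real (Xᶜ ∩ Y) = μ.real Y - μ.real (X ∩ Y) := by
    rw [Set.inter_comm Xᶜ Y, Set.inter_comm X Y]; exact measureReal_inter_compl_eq_sub μ hX
  have h2 : μ.real (Xᶜ ∩ Z) = μ.real Z - μ.real (X ∩ Z) := by
    rw [Set.inter_comm Xᶜ Z, Set.inter_comm X Z]; exact measureReal_inter_compl_eq_sub μ hX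
  have h3 : μ.real (X ∩ (Yᶜ ∩ Zᶜ)) = μ.real X - μ.real (X ∩ Y) - μ.real (X ∩ Z) + μ.real (X ∩ Y ∩ Z) := by
    have e1 : X ∩ (Yᶜ ∩ Zᶜ) = (X ∩ Yᶜ) ∩ Zᶜ := by rw [Set.inter_assoc]
    have e2 : μ.real ((X ∩ Yᶜ) ∩ Zᶜ) = μ.real (X ∩ Yᶜ) - μ.real (X ∩ Yᶜ ∩ Z) := measureReal_inter_compl_eq_sub μ hZ
    have e3 : μ.real (X ∩ Yᶜ) = μ.real X - μ.real (X ∩ Y) := measureReal_inter_compl_eq_sub μ hY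
    have e4 : X ∩ Yᶜ ∩ Z = (X ∩ Z) ∩ Yᶜ := by
      ext ω; simp only [Set.mem_inter_iff, Set.mem_compl_iff]; tauto
    have e5 : μ.real ((X ∩ Z) ∩ Yᶜ) = μ.real (X ∩ Z) - μ.real (X ∩ Z ∩ Y) := measureReal_inter_compl_eq_sub μ hY
    have e6 : X ∩ Z ∩ Y = X ∩ Y ∩ Z := by
      ext ω; simp only [Set.mem_inter_iff]; tauto
    rw [e1, e2, e3, e4, e5, e6]; ring
  have h4 : μ.real (Yᶜ ∩ Zᶜ) = 1 - μ.real Y - μ.real Z + μ.real (Y ∩ Z) := by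
    have e1 : μ.real (Yᶜ ∩ Zᶜ) = μ.real Yᶜ - μ.real (Yᶜ ∩ Z) := measureReal_inter_compl_eq_sub μ hZ
    have e2 : μ.real Yᶜ = 1 - μ.real Y := probReal_compl_eq_one_sub hY
    have e3 : μ.real (Yᶜ ∩ Z) = μ.real Z - μ.real (Y ∩ Z) := by
      rw [Set.inter_comm Yᶜ Z, Set.inter_comm Y Z]; exact measureReal_inter_compl_eq_sub μ hY
    rw [e1, e2, e3]; ring
  rw [sahiE3_compl₂ μ hY, sahiE3_compl₃ μ hZ, measureReal_inter_compl_eq_sub μ hZ, probReal_compl_eq_one_sub hZ, hXc, h1, h2,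
    h3, h4, sahiE3_def]
  ring

end ThreeTerm

section QBHK

variable {V : Type*} [Fintype V]
variable (w : Sym2 V → unitInterval) (S T : Set V) {A B : Set (BondConfig V)}
  (hA : ∀ ⦃ω ω' : BondConfig V⦄, (⋃ s ∈ S, openEdgeCluster ω s) ⊆ (⋃ s ∈ S, openEdgeCluster ω' s) → ω ∈ A → ω' ∈ A)
  (hB : ∀ ⦃ω ω' : BondConfig V⦄, (⋃ t ∈ T, openEdgeCluster ω t) ⊆ (⋃ t ∈ T, openEdgeCluster ω' t) → ω ∈ B → ω' ∈ B)

include hA hB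

/-- **Harris for the separation and the joint failure**: `μ(D)μ(Aᶜ∩Bᶜ) ≤ μ(D ∩ (Aᶜ∩Bᶜ))` (both events are decreasing).
[folklore; Harris 1960] -/
theorem harris_sep_compl_inter :
    (prodBernoulli w).real {ω : BondConfig V | ∀ s ∈ S, ∀ t ∈ T, ¬ (openGraph ω).Reachable s t} *
        (prodBernoulli w).real (Aᶜ ∩ Bᶜ) ≤
      (prodBernoulli w).real ({ω : BondConfig V | ∀ s ∈ S, ∀ t ∈ T, ¬ (openGraph ω).Reachable s t} ∩ (Aᶜ ∩ Bᶜ)) :=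
  prodBernoulli_harris_lower w (ClusterMarkovE3.isLowerSet_sepEv S T)
    ((isUpperSet_of_clusterMono S hA).compl.inter (isUpperSet_of_clusterMono T hB).compl)
    MeasurableSet.of_discrete MeasurableSet.of_discrete

omit hA hB in
/-- **The three-term identity for the typed percolation triple**:
`m·E₃(D, Aᶜ, Bᶜ) = c_A·c_B + m·Cov(1_D, 1_{Aᶜ∩Bᶜ}) − Δ*` with `c_A = μ(U∩A) − μ(U)μ(A) ≥ 0`, `c_B ≥ 0`, `Cov(1_D,1_{Aᶜ∩Bᶜ}) ≥ 0`
(Harris, `harris_three`, `harris_sep_compl_inter`) and `Δ* = μ(D∩A)μ(D∩B) − μ(D)μ(D∩A∩B) ≥ 0` (BHK, `bhk_deficit_nonneg`);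
`U = Dᶜ = {S ↔ T}`, `m = μ(D)`. [this work] -/
theorem mul_sahiE3_sep_compl_eq_threeTerm (A B : Set (BondConfig V)) :
    (prodBernoulli w).real {ω : BondConfig V | ∀ s ∈ S, ∀ t ∈ T, ¬ (openGraph ω).Reachable s t} *
        sahiE3 (prodBernoulli w) {ω : BondConfig V | ∀ s ∈ S, ∀ t ∈ T, ¬ (openGraph ω).Reachable s t} Aᶜ Bᶜ =
      ((prodBernoulli w).real ({ω : BondConfig V | ∀ s ∈ S, ∀ t ∈ T, ¬ (openGraph ω).Reachable s t}ᶜ ∩ A) -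
            (prodBernoulli w).real {ω : BondConfig V | ∀ s ∈ S, ∀ t ∈ T, ¬ (openGraph ω).Reachable s t}ᶜ *
              (prodBernoulli w).real A) *
          ((prodBernoulli w).real ({ω : BondConfig V | ∀ s ∈ S, ∀ t ∈ T, ¬ (openGraph ω).Reachable s t}ᶜ ∩ B) -
            (prodBernoulli w).real {ω : BondConfig V | ∀ s ∈ S, ∀ t ∈ T, ¬ (openGraph ω).Reachable s t}ᶜ *
              (prodBernoulli w).real B)
        + (prodBernoulli w).real {ω : BondConfig V | ∀ s ∈ S, ∀ t ∈ T, ¬ (openGraph ω).Reachable s t} *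
            ((prodBernoulli w).real ({ω : BondConfig V | ∀ s ∈ S, ∀ t ∈ T, ¬ (openGraph ω).Reachable s t} ∩ (Aᶜ ∩ Bᶜ)) -
              (prodBernoulli w).real {ω : BondConfig V | ∀ s ∈ S, ∀ t ∈ T, ¬ (openGraph ω).Reachable s t} *
                (prodBernoulli w).real (Aᶜ ∩ Bᶜ))
        - ((prodBernoulli w).real ({ω : BondConfig V | ∀ s ∈ S, ∀ t ∈ T, ¬ (openGraph ω).Reachable s t} ∩ A) *
              (prodBernoulli w).real ({ω : BondConfig V | ∀ s ∈ S, ∀ t ∈ T, ¬ (openGraph ω).Reachable s t} ∩ B) -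
            (prodBernoulli w).real {ω : BondConfig V | ∀ s ∈ S, ∀ t ∈ T, ¬ (openGraph ω).Reachable s t} *
              (prodBernoulli w).real ({ω : BondConfig V | ∀ s ∈ S, ∀ t ∈ T, ¬ (openGraph ω).Reachable s t} ∩ A ∩ B)) := by
  exact mul_sahiE3_compl_compl_eq (prodBernoulli w) MeasurableSet.of_discrete MeasurableSet.of_discrete
    MeasurableSet.of_discrete

omit hA hB in
/-- **G⁺ from the quantitative BHK bound (QBHK)** (pure algebra — holds for arbitrary `A, B`): if
`μ(D∩A)μ(D∩B) − μ(D)μ(D∩A∩B) ≤ Cov(U,A)·Cov(U,B) + μ(D)·Cov(1_D, 1_{Aᶜ∩Bᶜ})` then `0 ≤ E₃({S↮T}, Aᶜ, Bᶜ)`. [this work] -/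
theorem sahiE3_sep_compl_nonneg_of_qbhk
    (hQ : (prodBernoulli w).real ({ω : BondConfig V | ∀ s ∈ S, ∀ t ∈ T, ¬ (openGraph ω).Reachable s t} ∩ A) *
              (prodBernoulli w).real ({ω : BondConfig V | ∀ s ∈ S, ∀ t ∈ T, ¬ (openGraph ω).Reachable s t} ∩ B) -
            (prodBernoulli w).real {ω : BondConfig V | ∀ s ∈ S, ∀ t ∈ T, ¬ (openGraph ω).Reachable s t} *
              (prodBernoulli w).real ({ω : BondConfig V | ∀ s ∈ S, ∀ t ∈ T, ¬ (openGraph ω).Reachable s t} ∩ A ∩ B) ≤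
        ((prodBernoulli w).real ({ω : BondConfig V | ∀ s ∈ S, ∀ t ∈ T, ¬ (openGraph ω).Reachable s t}ᶜ ∩ A) -
            (prodBernoulli w).real {ω : BondConfig V | ∀ s ∈ S, ∀ t ∈ T, ¬ (openGraph ω).Reachable s t}ᶜ *
              (prodBernoulli w).real A) *
          ((prodBernoulli w).real ({ω : BondConfig V | ∀ s ∈ S, ∀ t ∈ T, ¬ (openGraph ω).Reachable s t}ᶜ ∩ B) -
            (prodBernoulli w).real {ω : BondConfig V | ∀ s ∈ S, ∀ t ∈ T, ¬ (openGraph ω).Reachable s t}ᶜ *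
              (prodBernoulli w).real B)
        + (prodBernoulli w).real {ω : BondConfig V | ∀ s ∈ S, ∀ t ∈ T, ¬ (openGraph ω).Reachable s t} *
            ((prodBernoulli w).real ({ω : BondConfig V | ∀ s ∈ S, ∀ t ∈ T, ¬ (openGraph ω).Reachable s t} ∩ (Aᶜ ∩ Bᶜ)) -
              (prodBernoulli w).real {ω : BondConfig V | ∀ s ∈ S, ∀ t ∈ T, ¬ (openGraph ω).Reachable s t} *
                (prodBernoulli w).real (Aᶜ ∩ Bᶜ))) :
    0 ≤ sahiE3 (prodBernoulli w) {ω : BondConfig V | ∀ s ∈ S, ∀ t ∈ T, ¬ (openGraph ω).Reachable s t} Aᶜ Bᶜ := by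
  have hid := mul_sahiE3_sep_compl_eq_threeTerm w S T A B
  set μ := prodBernoulli w with hμ
  set D := {ω : BondConfig V | ∀ s ∈ S, ∀ t ∈ T, ¬ (openGraph ω).Reachable s t} with hD
  have hm0 : 0 ≤ μ.real D := measureReal_nonneg
  rcases hm0.eq_or_lt with hm | hm
  · rw [sahiE3_comm₁₂, sahiE3_comm₂₃, sahiE3_eq_zero_of_measureReal_eq_zero μ Aᶜ Bᶜ D hm.symm]
  · have hprod : 0 ≤ μ.real D * sahiE3 μ D Aᶜ Bᶜ := by rw [hid]; linarith
    exact (mul_nonneg_iff_of_pos_left hm).1 hprod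

omit hA hB in
/-- **QBHK from G⁺** (converse direction, pointwise): `0 ≤ E₃({S↮T}, Aᶜ, Bᶜ)` implies the quantitative BHK bound. [this work] -/
theorem qbhk_of_sahiE3_sep_compl_nonneg (A B : Set (BondConfig V))
    (hE : 0 ≤ sahiE3 (prodBernoulli w) {ω : BondConfig V | ∀ s ∈ S, ∀ t ∈ T, ¬ (openGraph ω).Reachable s t} Aᶜ Bᶜ) :
    (prodBernoulli w).real ({ω : BondConfig V | ∀ s ∈ S, ∀ t ∈ T, ¬ (openGraph ω).Reachable s t} ∩ A) *
          (prodBernoulli w).real ({ω : BondConfig V | ∀ s ∈ S, ∀ t ∈ T, ¬ (openGraph ω).Reachable s t} ∩ B) -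
        (prodBernoulli w).real {ω : BondConfig V | ∀ s ∈ S, ∀ t ∈ T, ¬ (openGraph ω).Reachable s t} *
          (prodBernoulli w).real ({ω : BondConfig V | ∀ s ∈ S, ∀ t ∈ T, ¬ (openGraph ω).Reachable s t} ∩ A ∩ B) ≤
      ((prodBernoulli w).real ({ω : BondConfig V | ∀ s ∈ S, ∀ t ∈ T, ¬ (openGraph ω).Reachable s t}ᶜ ∩ A) -
          (prodBernoulli w).real {ω : BondConfig V | ∀ s ∈ S, ∀ t ∈ T, ¬ (openGraph ω).Reachable s t}ᶜ *
            (prodBernoulli w).real A) *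
        ((prodBernoulli w).real ({ω : BondConfig V | ∀ s ∈ S, ∀ t ∈ T, ¬ (openGraph ω).Reachable s t}ᶜ ∩ B) -
          (prodBernoulli w).real {ω : BondConfig V | ∀ s ∈ S, ∀ t ∈ T, ¬ (openGraph ω).Reachable s t}ᶜ *
            (prodBernoulli w).real B)
      + (prodBernoulli w).real {ω : BondConfig V | ∀ s ∈ S, ∀ t ∈ T, ¬ (openGraph ω).Reachable s t} *
          ((prodBernoulli w).real ({ω : BondConfig V | ∀ s ∈ S, ∀ t ∈ T, ¬ (openGraph ω).Reachable s t} ∩ (Aᶜ ∩ Bᶜ)) -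
            (prodBernoulli w).real {ω : BondConfig V | ∀ s ∈ S, ∀ t ∈ T, ¬ (openGraph ω).Reachable s t} *
              (prodBernoulli w).real (Aᶜ ∩ Bᶜ)) := by
  have hid := mul_sahiE3_compl_compl_eq (prodBernoulli w) (X := {ω : BondConfig V | ∀ s ∈ S, ∀ t ∈ T, ¬ (openGraph ω).Reachable s t})
    (Y := A) (Z := B) MeasurableSet.of_discrete MeasurableSet.of_discrete MeasurableSet.of_discrete
  have hm0 : 0 ≤ (prodBernoulli w).real {ω : BondConfig V | ∀ s ∈ S, ∀ t ∈ T, ¬ (openGraph ω).Reachable s t} :=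
    measureReal_nonneg
  nlinarith [mul_nonneg hm0 hE]

end QBHK

end Summit.CriticalPhenomena.PercolationContinuityZ3.Theorems.FrontierDecRows

end
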